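import Mathlib.LinearAlgebra.Matrix.Kronecker
import Literature.MathematicalPhysics.QuantumLattice.SpinTwistedHubbardTorus
import Literature.MathematicalPhysics.QuantumLattice.ProductOperators
import HarnessLib

/-!
# The Hubbard torus minimally coupled to a compact `U(1)` lattice gauge field

Trunk T-QLATTICE (family `hubbard`; requested by route `EatTheGoldstone`, crux
`GaugedZ2TopologicalOrder`). The 2D Hubbard model `hubbardTorus 2 L 1 U` on the fermionic torus
`(ℤ/Lℤ)²` minimally coupled to a *dynamical* Kogut–Susskind `U(1)` gauge field living on the
oriented bonds `b = (x, i)` (from `x` to `x + eᵢ`), as a finite Hermitian matrix together with its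
Gauss-law constraint, in the **electric-flux basis** (Bietenholz–Wiese §11.7, eqs. (11.46)–(11.52);
Kogut–Susskind 1975; Fradkin 2013, §9.11 (9.78)–(9.81) and §9.12 (9.83)–(9.84)):

* link Hilbert space `ℂ^{2M+1}` per bond with basis `|m⟩`, `m ∈ {-M, …, M}` the integer electric
  flux (`J_b |m⟩ = m |m⟩`, eq. (11.46)), TRUNCATED at `|m| ≤ M`; the parallel transporter is the
  truncated raising operator `U_b |m⟩ = |m+1⟩`, `U_b |M⟩ = 0`, so that `[J_b, U_b] = U_b`
  (eq. (11.47)) holds EXACTLY on the truncated space (`fluxOp_commutator_raise`);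
* `GaugedHubbard.Index L M = (occupation configurations) × (flux configurations)`, operators are
  matrices on it, tensor products are Mathlib's Kronecker product `⊗ₖ`; the link algebra is the
  spin-system algebra `Op (Bond L) (2M+1)` of `SpinSystem.lean` (`onSite`);
* `gaugedHubbardTorusWith L U gE gB M =`
  `-Σ_{b=(x,i),σ} (c†_{xσ} c_{x+eᵢ,σ} ⊗ U_b + h.c.) + U Σ_x n_{x↑} n_{x↓} ⊗ 1`
  `+ gE · 1 ⊗ Σ_b J_b² + gB · 1 ⊗ Σ_p (2 - W_p - W_pᴴ)`,
  `W_p = U_{(x,0)} U_{(x+e₀,1)} U_{(x+e₁,0)}ᴴ U_{(x,1)}ᴴ` (eq. (11.48) with matter, Fradkin (9.83));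
  the physical one-parameter family is `gaugedHubbardTorus L U e M = …With L U (e²/2) (1/(2e²)) M`
  (hopping amplitude `t = 1`, as in the summit statement);
* Gauss law (eqs. (11.50)–(11.52), Fradkin (9.84)): `gaussCharge ρ y (s, k) = (div k)(y) - n_y(s) + ρ y`
  with an INTEGER background charge pattern `ρ : sites → ℤ`; `gaussGenerator ρ y` is the diagonal
  operator `G_y`, `IsGaussLaw ρ` the constraint `∀ y, G_y = 0` on basis states, `gaussProj ρ` the
  (diagonal, commuting) constraint projector, `gaussLawSubspace ρ` the joint kernel, and
  `gaugedHubbardTorusPhys L U e M ρ` the physical object: the compression of `H_e` to the basis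
  states obeying the Gauss law with `2S^z = 0` (a coordinate sector, cf. `sector_groundState`).

API (all proved): `[J_b, U_b] = U_b`; hermiticity of `H` and of the physical block; the grading
calculus `HasShift` (`A i j ≠ 0 → d i = d j + c`) and with it GAUGE INVARIANCE
`Commute (gaussGenerator ρ y) (gaugedHubbardTorusWith …)` for every site `y` and background `ρ`,
the block structure `H i j = 0` between different Gauss / `S^z` sectors, `[G_x, G_y] = 0`,
`gaussProj` is an idempotent Hermitian matrix commuting with `H`, the Gauss-law subspace is the
coordinate subspace cut out by `IsGaussLaw`, and on it the particle number is `Σ ρ`.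

## Which `e`-convention (requested by the route's `HiggsTransfer`)

`e` is the Kogut–Susskind coupling `g`: writing `J_b = E_b / e` and, formally, `U_b = exp(i e a_b)`,
`W_p = exp(i e Φ_p)`, the pure-gauge part is `½ Σ_b E_b² + e⁻² Σ_p (1 - cos (e Φ_p))`
`= ½ Σ_b E_b² + ½ Σ_p Φ_p² + O(e² Φ⁴)`: the harmonic (free-photon) part is `e`-INDEPENDENT and the
electrons see the Peierls factor `exp(i e a_b) → 1`; only the compactification radius `2π/e` of
`a_b`, the flux quantum `E_b ∈ eℤ` and the truncation `|E_b| ≤ eM` depend on `e` (so `M` must grow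
like `1/e` for the photon ground state to fit). There is NO member `e = 0` of the family
(`gaugedHubbardTorus L U 0 M` carries Lean's junk value `1/0 = 0`: no Maxwell terms at all); the
route's "`e → 0`" is the `g → 0` asymptotics of this family, and the large gauge transformations
`exp(2πi Σ_x xᵢ n_x / L) · (shift of a by 2π/L on i-bonds)` are ORDINARY gauge transformations here
(`x ↦ exp(2πi xᵢ/L)` is single-valued on the torus and `J_b ∈ ℤ`), i.e. products of
`exp(i λ_y G_y)`, automatically trivial on the Gauss-law subspace.

## Why the compact flux-basis truncation and not truncated photon oscillators

For a finite-dimensional link space with an `e`-independent electric operator `E_b` of finite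
spectrum `S`, exact gauge invariance of `c†_x W_b(e) c_{x+eᵢ}` forces `W_b(e)` to map the
`E_b = s` eigenspace into the `E_b = s + e` eigenspace, hence `W_b(e) = 0` for all small `e ≠ 0`
unless `S ⊆ s₀ + eℤ` — the flux basis above. With oscillator (Hermite) truncations the joint kernel
of the `G_y` is moreover generically `{0}`. The flux-basis truncation keeps `[H, G_y] = 0`,
`[G_x, G_y] = 0` and a large physical subspace exactly, at the price of the non-unitarity
`U_b U_bᴴ ≠ 1` at the cut-off `|m| = M` (standard in Hamiltonian truncations of `U(1)` lattice
gauge theory).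

## Degenerate sides, junk values

`L ≥ 1` (`[NeZero L]`). For `L ≥ 3` the bonds `(x, i)` are in bijection with the edges of
`fermionTorusGraph 2 L`; for `L = 2` the bonds `(x, i)` and `(x + eᵢ, i)` are the two distinct
bonds of the `2 × 2` torus joining the same pair of sites (double edges, absent from the simple
graph), and for `L = 1` every bond is a loop. `gaugedHubbardTorus L U 0 M`: see above.

## What is NOT here

The truncation-removal (`M → ∞`) statement; the Born–Oppenheimer / `e → 0` reduction to the
flux-threaded pure torus (route items `HiggsTransfer`, `GaugedDictionary`); Wilson-line holonomy
operators; the `ℤ₂` gauge–Higgs (toric code in a field) anchor as an `Interaction` (Fradkin 2013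
§9.10 (9.76); Hansson–Oganesyan–Sondhi 2004 §5.1–5.2) — separate files.

## Sources

J. Kogut, L. Susskind, Phys. Rev. D 11 (1975) 395; W. Bietenholz, U.-J. Wiese, *Uncovering
Quantum Field Theory and the Standard Model* (CUP 2025) §11.7, §11.9; E. Fradkin, *Field Theories
of Condensed Matter Physics* (2nd ed., CUP 2013) §§9.10–9.12, §14.5; T. H. Hansson, V. Oganesyan,
S. L. Sondhi, Ann. Phys. 313 (2004) 497, §5.2; E. Fradkin, S. Shenker, Phys. Rev. D 19 (1979) 3682.

## Mathlib / tree search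

Mathlib: `Matrix.kronecker` (`⊗ₖ`, `mul_kronecker_mul`, `conjTranspose_kronecker`), `Matrix.diagonal`,
`Matrix.submatrix`, `Matrix.IsHermitian`; no lattice gauge theory (`rg -i "gauss law|kogut"`:
nothing). Tree: `FermionTorus`, `creation`/`annihilation`/`numberOp` (`HubbardWave0`,
`FermionOperators`), `Op`/`onSite` (`SpinSystem`, `ProductOperators`) and the unit shifts
`FermionTorus.shift`/`unshift` (`x ± e_μ`, `SpinTwistedHubbardTorus`) are reused; the Euclidean
`WilsonLoops`/`LatticeGaugeDLR` files concern path-integral lattice gauge theory and are not used.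
`DecidableEq (GaugedHubbard.Index L M)` is recorded as an explicit instance assembled from the two
factors: the default search finds it but exceeds `synthInstance.maxSize` (the instance term of the
deep synonym chain `Finset (Lex (Lex (Fin 2 → Fin L) × Fin 2))` is large); `Decidable` instances are
subsingletons, so this duplicates nothing.
-/

noncomputable section

namespace Literature.MathematicalPhysics.QuantumLattice

open Matrix Finset Literature.Probability.LatticeModels
open scoped Kronecker

/-! ### Unit shifts of the fermionic torus commute -/

namespace FermionTorus

variable {d L : ℕ} [NeZero L]

/-- `x + e_μ = y ↔ x = y - e_μ` (unit shifts of `SpinTwistedHubbardTorus.lean`). [folklore] -/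
theorem shift_eq_iff_eq_unshift (x y : FermionTorus d L) (μ : Fin d) :
    shift x μ = y ↔ x = unshift y μ := by
  constructor
  · rintro rfl
    rw [unshift_shift]
  · rintro rfl
    rw [shift_unshift]

/-- Unit shifts in different directions commute: `(x + e_μ) + e_ν = (x + e_ν) + e_μ`. [folklore] -/
theorem shift_shift_comm (x : FermionTorus d L) (μ ν : Fin d) :
    shift (shift x μ) ν = shift (shift x ν) μ :=
  toTorusSite_injective (by rw [toTorusSite_shift, toTorusSite_shift, toTorusSite_shift,
    toTorusSite_shift, add_right_comm])

end FermionTorus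

namespace GaugedHubbard

/-! ### A grading calculus for matrix entries -/

section HasShift

variable {ι κ : Type*}

/-- `HasShift d A c`: the matrix `A` raises the integer grading `d` of basis states by exactly `c`,
i.e. `A i j ≠ 0 → d i = d j + c` ("`A` carries charge `c` under the diagonal operator `d`").
The bookkeeping behind `[Q(x), H] = 0`, Fradkin (2013) §9.11 eq. (9.80). [folklore] -/
def HasShift (d : ι → ℤ) (A : Matrix ι ι ℂ) (c : ℤ) : Prop :=
  ∀ i j, A i j ≠ 0 → d i = d j + c

namespace HasShift

variable {d : ι → ℤ} {A B : Matrix ι ι ℂ} {a b c : ℤ}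

/-- Entries between the wrong sectors vanish. [folklore] -/
theorem apply_eq_zero (hA : HasShift d A c) {i j : ι} (h : d i ≠ d j + c) : A i j = 0 := by
  by_contra h0
  exact h (hA i j h0)

/-- Relabelling the charge. [folklore] -/
theorem of_eq (hA : HasShift d A c) (h : c = b) : HasShift d A b := h ▸ hA

/-- Relabelling the grading. [folklore] -/
theorem congr_grading {d' : ι → ℤ} (hA : HasShift d A c) (h : d = d') : HasShift d' A c := h ▸ hA

/-- Reversing (and shifting) the grading negates the charge. [folklore] -/
theorem neg_grading (hA : HasShift d A c) (r : ℤ) : HasShift (fun i => r - d i) A (-c) := by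
  intro i j h
  have := hA i j h
  show r - d i = r - d j + -c
  omega

/-- The trivial grading sees no charge. [folklore] -/
theorem of_const (A : Matrix ι ι ℂ) (r : ℤ) : HasShift (fun _ : ι => r) A 0 :=
  fun _ _ _ => by simp

/-- Sums of equally charged matrices. [folklore] -/
theorem add (hA : HasShift d A c) (hB : HasShift d B c) : HasShift d (A + B) c := by
  intro i j h
  rw [Matrix.add_apply] at h
  by_cases hA0 : A i j = 0
  · rw [hA0, zero_add] at h
    exact hB i j h
  · exact hA i j hA0

/-- Negation. [folklore] -/
theorem neg (hA : HasShift d A c) : HasShift d (-A) c :=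
  fun i j h => hA i j (by simpa using h)

/-- Differences of equally charged matrices. [folklore] -/
theorem sub (hA : HasShift d A c) (hB : HasShift d B c) : HasShift d (A - B) c := by
  rw [sub_eq_add_neg]
  exact hA.add hB.neg

/-- Scalar multiples. [folklore] -/
theorem smul (hA : HasShift d A c) (r : ℂ) : HasShift d (r • A) c :=
  fun i j h => hA i j (by
    intro h0
    apply h
    rw [Matrix.smul_apply, h0, smul_zero])

/-- Finite sums of equally charged matrices. [folklore] -/
theorem sum {α : Type*} (s : Finset α) {F : α → Matrix ι ι ℂ}
    (h : ∀ x ∈ s, HasShift d (F x) c) : HasShift d (∑ x ∈ s, F x) c := by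
  classical
  induction s using Finset.induction_on with
  | empty =>
    intro i j hij
    simp at hij
  | insert x s hx ih =>
    rw [Finset.sum_insert hx]
    exact (h x (Finset.mem_insert_self x s)).add
      (ih fun y hy => h y (Finset.mem_insert_of_mem hy))

/-- Charges add under products. [folklore] -/
theorem mul [Fintype ι] (hA : HasShift d A a) (hB : HasShift d B b) :
    HasShift d (A * B) (a + b) := by
  intro i j h
  rw [Matrix.mul_apply] at h
  obtain ⟨k, -, hk⟩ := Finset.exists_ne_zero_of_sum_ne_zero h
  rw [hA i k (left_ne_zero_of_mul hk), hB k j (right_ne_zero_of_mul hk)]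
  ring

/-- The adjoint carries the opposite charge. [folklore] -/
theorem conjTranspose (hA : HasShift d A c) : HasShift d Aᴴ (-c) := by
  intro i j h
  rw [conjTranspose_apply, star_ne_zero] at h
  have := hA j i h
  omega

/-- Diagonal matrices are neutral. [folklore] -/
theorem diagonal [DecidableEq ι] (f : ι → ℂ) : HasShift d (Matrix.diagonal f) 0 := by
  intro i j h
  by_cases hij : i = j
  · subst hij
    simp
  · exact absurd (Matrix.diagonal_apply_ne f hij) h

/-- The identity is neutral. [folklore] -/
theorem one [DecidableEq ι] : HasShift d (1 : Matrix ι ι ℂ) 0 := by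
  intro i j h
  by_cases hij : i = j
  · subst hij
    simp
  · exact absurd (Matrix.one_apply_ne hij) h

/-- Charges add under the Kronecker (tensor) product, for the sum grading. [folklore] -/
theorem kronecker {d₁ : ι → ℤ} {d₂ : κ → ℤ} {A : Matrix ι ι ℂ} {B : Matrix κ κ ℂ} {a b : ℤ}
    (hA : HasShift d₁ A a) (hB : HasShift d₂ B b) :
    HasShift (fun ik : ι × κ => d₁ ik.1 + d₂ ik.2) (A ⊗ₖ B) (a + b) := by
  rintro ⟨i, k⟩ ⟨j, l⟩ h
  rw [Matrix.kronecker_apply] at h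
  have h₁ := hA i j (left_ne_zero_of_mul h)
  have h₂ := hB k l (right_ne_zero_of_mul h)
  show d₁ i + d₂ k = d₁ j + d₂ l + (a + b)
  omega

/-- A matrix commutes with every diagonal matrix that is constant on the pairs of basis states it
connects; this is `[Q(x), H] = 0` from charge bookkeeping, Fradkin (2013) §9.11 eq. (9.80).
[folklore] -/
theorem commute_diagonal [Fintype ι] [DecidableEq ι] {g : ι → ℂ}
    (h : ∀ i j, A i j ≠ 0 → g i = g j) : Commute (Matrix.diagonal g) A := by
  rw [Commute, SemiconjBy]
  ext i j
  rw [Matrix.diagonal_mul, Matrix.mul_diagonal]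
  by_cases h0 : A i j = 0
  · simp [h0]
  · rw [h i j h0, mul_comm]

end HasShift

/-! ### Charges of the fermion operators -/

/-- The additive grading of occupation configurations by orbital weights,
`wt w s = Σ_{o ∈ s} w o` (`w = 1`: particle number; `w = ±1` by spin: `2S^z`; `w = [site = y]`:
the charge at `y`). [folklore] -/
def wt {ι' : Type*} (w : ι' → ℤ) (s : Finset ι') : ℤ := ∑ o ∈ s, w o

/-- Nonzero entries of `c†_i`: `⟨s| c†_i |t⟩ ≠ 0` forces `s = t ∪ {i}`, `i ∉ t`.
Bratteli–Robinson II §5.2.2. [folklore] -/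
theorem creation_apply_ne_zero {ι' : Type*} [LinearOrder ι'] {i : ι'} {s t : Finset ι'}
    (h : creation i s t ≠ 0) : i ∉ t ∧ s = insert i t := by
  simp only [creation, conjTranspose_apply, annihilation] at h
  split_ifs at h with hc
  · exact hc
  · exact absurd (star_zero ℂ) h

/-- `c†_i` raises the weight grading by `w i`. [folklore] -/
theorem hasShift_creation {ι' : Type*} [LinearOrder ι'] (w : ι' → ℤ) (i : ι') :
    HasShift (wt w) (creation i) (w i) := by
  intro s t h
  obtain ⟨hi, rfl⟩ := creation_apply_ne_zero h
  rw [wt, wt, Finset.sum_insert hi, add_comm]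

/-- `c_i` lowers the weight grading by `w i`. [folklore] -/
theorem hasShift_annihilation {ι' : Type*} [LinearOrder ι'] (w : ι' → ℤ) (i : ι') :
    HasShift (wt w) (annihilation i) (-w i) := by
  simpa using (hasShift_creation w i).conjTranspose

end HasShift

/-! ### Bonds, fluxes and the truncated link algebra -/

section Links

/-- The oriented bonds `b = (x, i)` of the two-dimensional torus, from `x` to `x + eᵢ`; the gauge
field lives on them. Bietenholz–Wiese (2025) §11.7. [folklore] -/
abbrev Bond (L : ℕ) : Type := FermionTorus 2 L × Fin 2

/-- The integer electric flux `m ∈ {-M, …, M}` carried by the basis state `|a⟩`, `a : Fin (2M+1)`,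
of the truncated link space (`m = a - M`). Bietenholz–Wiese (2025) §11.7, eq. (11.46). [folklore] -/
def flux (M : ℕ) (a : Fin (2 * M + 1)) : ℤ := (a : ℤ) - M

/-- The truncated parallel transporter `U |m⟩ = |m+1⟩` (`U |M⟩ = 0`) on the link space `ℂ^{2M+1}`
in the flux basis. Bietenholz–Wiese (2025) §11.7, eq. (11.47) (`[J, U] = U`), truncated. [folklore] -/
def raise (M : ℕ) : Matrix (Fin (2 * M + 1)) (Fin (2 * M + 1)) ℂ :=
  of fun a b => if (a : ℕ) = (b : ℕ) + 1 then 1 else 0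

/-- The electric flux operator `J |m⟩ = m |m⟩` on the link space `ℂ^{2M+1}`.
Bietenholz–Wiese (2025) §11.7, eq. (11.46). [folklore] -/
def fluxOp (M : ℕ) : Matrix (Fin (2 * M + 1)) (Fin (2 * M + 1)) ℂ :=
  diagonal fun a => ((flux M a : ℤ) : ℂ)

/-- Entries of the truncated transporter. [folklore] -/
@[simp] theorem raise_apply (M : ℕ) (a b : Fin (2 * M + 1)) :
    raise M a b = if (a : ℕ) = (b : ℕ) + 1 then 1 else 0 := rfl

/-- **The flux-basis commutation relation survives truncation exactly**: `J U - U J = U`.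
Bietenholz–Wiese (2025) §11.7, eq. (11.47). [folklore] -/
theorem fluxOp_commutator_raise (M : ℕ) :
    fluxOp M * raise M - raise M * fluxOp M = raise M := by
  ext a b
  simp only [fluxOp, Matrix.sub_apply, diagonal_mul, mul_diagonal, raise_apply, flux]
  split_ifs with h
  · push_cast
    rw [h]
    push_cast
    ring
  · simp

/-- The flux operator is Hermitian (real diagonal). [folklore] -/
theorem fluxOp_isHermitian (M : ℕ) : (fluxOp M).IsHermitian := by
  rw [fluxOp]
  refine isHermitian_diagonal_of_self_adjoint _ (funext fun a => ?_)
  simp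

variable (L M : ℕ)

/-- The transporter `U_b` of the bond `b`, acting on the tensor product of all link spaces
(`onSite`). Bietenholz–Wiese (2025) §11.7, eq. (11.47). [folklore] -/
def linkRaise (b : Bond L) : Op (Bond L) (2 * M + 1) := onSite b (raise M)

/-- The flux operator `J_b` of the bond `b` on the tensor product of all link spaces.
Bietenholz–Wiese (2025) §11.7, eq. (11.46). [folklore] -/
def linkFlux (b : Bond L) : Op (Bond L) (2 * M + 1) := onSite b (fluxOp M)

/-- `[J_b, U_b] = U_b` on the full link space. Bietenholz–Wiese (2025) §11.7, eq. (11.47).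
[folklore] -/
theorem linkFlux_commutator_linkRaise (b : Bond L) :
    linkFlux L M b * linkRaise L M b - linkRaise L M b * linkFlux L M b = linkRaise L M b := by
  rw [linkFlux, linkRaise, onSite_mul, onSite_mul, ← onSite_sub', fluxOp_commutator_raise]

/-- The electric energy `Σ_b J_b²`. Bietenholz–Wiese (2025) §11.7, eq. (11.48). [folklore] -/
def electric : Op (Bond L) (2 * M + 1) :=
  ∑ b : Bond L, linkFlux L M b * linkFlux L M b

/-- The electric energy is Hermitian. [folklore] -/
theorem electric_isHermitian : (electric L M).IsHermitian := by
  rw [electric, IsHermitian, conjTranspose_sum]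
  refine Finset.sum_congr rfl fun b _ => ?_
  have h : (linkFlux L M b)ᴴ = linkFlux L M b :=
    (onSite_isHermitian b (fluxOp_isHermitian M)).eq
  rw [conjTranspose_mul, h]

/-- Basis states of the coupled system: an occupation configuration of the `2L²` spin-orbitals
times an electric-flux configuration of the `2L²` bonds. Kogut–Susskind (1975); Bietenholz–Wiese
(2025) §11.7. [folklore] -/
abbrev Index (L M : ℕ) : Type :=
  Finset (Orb (FermionTorus 2 L)) × TensorIndex (Bond L) (2 * M + 1)

/-- Decidable equality of basis states, assembled from the two factors (the default instance
search succeeds but its result exceeds `synthInstance.maxSize`; `Decidable` instances are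
subsingletons, so nothing is overridden). [folklore] -/
instance instDecidableEqIndex : DecidableEq (Index L M) :=
  @instDecidableEqProd _ _ inferInstance inferInstance

/-- `Σ_x n_{x↑} n_{x↓}` is Hermitian (commuting Hermitian number operators). [folklore] -/
theorem isHermitian_sum_numberOp_mul :
    (∑ x : FermionTorus 2 L, numberOp x 0 * numberOp x 1 :
      Matrix (Finset (Orb (FermionTorus 2 L))) _ ℂ).IsHermitian := by
  rw [IsHermitian, conjTranspose_sum]
  refine Finset.sum_congr rfl fun x _ => ?_
  rw [conjTranspose_mul, ← numberAt_orb, ← numberAt_orb, (numberAt_isHermitian _).eq,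
    (numberAt_isHermitian _).eq]
  exact (numberAt_commute _ _).eq

/-- Real multiples of Hermitian matrices are Hermitian. [folklore] -/
theorem isHermitian_real_smul {n : Type*} {A : Matrix n n ℂ} (r : ℝ) (hA : A.IsHermitian) :
    ((r : ℂ) • A).IsHermitian := by
  rw [IsHermitian, conjTranspose_smul, hA.eq]
  simp only [Complex.star_def, Complex.conj_ofReal]

/-- Kronecker products of Hermitian matrices are Hermitian. [folklore] -/
theorem isHermitian_kronecker {m n : Type*} {A : Matrix m m ℂ} {B : Matrix n n ℂ}
    (hA : A.IsHermitian) (hB : B.IsHermitian) : (A ⊗ₖ B).IsHermitian := by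
  rw [IsHermitian, conjTranspose_kronecker, hA.eq, hB.eq]

/-- The weighted flux grading `k ↦ Σ_b v b · m_b` of flux configurations. [folklore] -/
def linkGrade (v : Bond L → ℤ) (k : TensorIndex (Bond L) (2 * M + 1)) : ℤ :=
  ∑ b, v b * flux M (k b)

/-- Charge of `U_b` under the weighted flux grading `Σ_{b'} v b' · m_{b'}`: it is `v b`
(`U_b` raises `m_b` by one and leaves the other links alone). Bietenholz–Wiese (2025) §11.7,
eq. (11.47). [folklore] -/
theorem hasShift_linkRaise (v : Bond L → ℤ) (b : Bond L) :
    HasShift (linkGrade L M v) (linkRaise L M b) (v b) := by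
  intro k k' hne
  rw [linkRaise, onSite_apply] at hne
  split_ifs at hne with hoff
  · have hb : flux M (k b) = flux M (k' b) + 1 := by
      rw [raise_apply] at hne
      split_ifs at hne with h1
      · simp only [flux, h1]
        push_cast
        ring
      · exact absurd rfl hne
    have key : ∀ b', v b' * flux M (k b') =
        v b' * flux M (k' b') + (if b' = b then v b else 0) := by
      intro b'
      by_cases hb' : b' = b
      · subst hb'
        rw [if_pos rfl, hb]
        ring
      · rw [if_neg hb', hoff b' hb', add_zero]
    simp only [linkGrade, key, Finset.sum_add_distrib, Finset.sum_ite_eq', Finset.mem_univ,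
      if_true]
  · exact absurd rfl hne

/-- Single-link operators built from a diagonal matrix are neutral for every grading.
[folklore] -/
theorem hasShift_onSite_diagonal (d : TensorIndex (Bond L) (2 * M + 1) → ℤ) (b : Bond L)
    (f : Fin (2 * M + 1) → ℂ) : HasShift d (onSite b (Matrix.diagonal f)) 0 := by
  intro k k' hne
  rw [onSite_apply] at hne
  split_ifs at hne with hoff
  · have hkb : k b = k' b := by
      by_contra h
      exact hne (Matrix.diagonal_apply_ne f h)
    have : k = k' := funext fun b' => by
      by_cases hb' : b' = b
      · rw [hb', hkb]
      · exact hoff b' hb'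
    rw [this, add_zero]
  · exact absurd rfl hne

/-- The electric energy is neutral for every flux grading. [folklore] -/
theorem hasShift_electric (d : TensorIndex (Bond L) (2 * M + 1) → ℤ) :
    HasShift d (electric L M) 0 := by
  unfold electric
  refine HasShift.sum _ fun b _ => ?_
  rw [linkFlux, fluxOp]
  simpa using (hasShift_onSite_diagonal L M d b _).mul (hasShift_onSite_diagonal L M d b _)

end Links

/-! ### The coupled system -/

section Model

variable (L M : ℕ) [NeZero L]

/-- The gauge-covariant hopping `Σ_{b=(x,i)} Σ_σ c†_{xσ} c_{x+eᵢ,σ} ⊗ U_b` (one orientation; the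
Hamiltonian contains this plus its adjoint). Fradkin (2013) §9.12, eq. (9.83) (matter term);
Kogut–Susskind (1975). [cite: Fradkin2013, §9.12 eq. (9.83)] -/
def hopCore : Matrix (Index L M) (Index L M) ℂ :=
  ∑ b : Bond L, ∑ σ : Fin 2,
    (creation (orb b.1 σ) * annihilation (orb (b.1.shift b.2) σ)) ⊗ₖ
      linkRaise L M b

/-- The plaquette loop `W_p = U_{(x,0)} U_{(x+e₀,1)} U_{(x+e₁,0)}ᴴ U_{(x,1)}ᴴ` based at `x`.
Bietenholz–Wiese (2025) §11.7, eq. (11.48). [folklore] -/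
def plaquetteLoop (x : FermionTorus 2 L) : Op (Bond L) (2 * M + 1) :=
  linkRaise L M (x, 0) * linkRaise L M (x.shift 0, 1) *
    (linkRaise L M (x.shift 1, 0))ᴴ * (linkRaise L M (x, 1))ᴴ

/-- The magnetic energy `Σ_p (2 - W_p - W_pᴴ)`, written as `Σ_p ((1 - W_p) + (1 - W_p)ᴴ)`.
Bietenholz–Wiese (2025) §11.7, eq. (11.48). [folklore] -/
def magnetic : Op (Bond L) (2 * M + 1) :=
  ∑ x : FermionTorus 2 L, ((1 - plaquetteLoop L M x) + (1 - plaquetteLoop L M x)ᴴ)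

/-- The magnetic energy is Hermitian. [folklore] -/
theorem magnetic_isHermitian : (magnetic L M).IsHermitian := by
  rw [magnetic, IsHermitian, conjTranspose_sum]
  exact Finset.sum_congr rfl fun x _ => (isHermitian_add_transpose_self _).eq

end Model

end GaugedHubbard

open GaugedHubbard

/-- **The gauged Hubbard torus with independent electric and magnetic couplings**:
`H = -Σ_{b=(x,i),σ} (c†_{xσ} c_{x+eᵢ,σ} ⊗ U_b + h.c.) + U Σ_x n_{x↑}n_{x↓} ⊗ 1 + gE · 1 ⊗ Σ_b J_b²`
`+ gB · 1 ⊗ Σ_p (2 - W_p - W_pᴴ)` on `GaugedHubbard.Index L M` (hopping amplitude `1`). The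
compact `U(1)` Kogut–Susskind Hamiltonian coupled to Hubbard fermions, electric fluxes truncated
at `|m| ≤ M`. Kogut–Susskind (1975); Bietenholz–Wiese (2025) §11.7 eq. (11.48); Fradkin (2013)
§9.12 eq. (9.83). [cite: BietenholzWiese2025, §11.7 eqs. (11.47)–(11.48)] -/
def gaugedHubbardTorusWith (L : ℕ) [NeZero L] (U gE gB : ℝ) (M : ℕ) :
    Matrix (Index L M) (Index L M) ℂ :=
  -(hopCore L M + (hopCore L M)ᴴ) +
    (U : ℂ) • ((∑ x : FermionTorus 2 L, numberOp x 0 * numberOp x 1) ⊗ₖ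
      (1 : Op (Bond L) (2 * M + 1))) +
    (gE : ℂ) • ((1 : Matrix (Finset (Orb (FermionTorus 2 L))) _ ℂ) ⊗ₖ electric L M) +
    (gB : ℂ) • ((1 : Matrix (Finset (Orb (FermionTorus 2 L))) _ ℂ) ⊗ₖ magnetic L M)

/-- **The gauged Hubbard torus** `H_e(L, U)`: `hubbardTorus 2 L 1 U` minimally coupled to compact
lattice QED of coupling `e`, i.e. `gaugedHubbardTorusWith L U (e²/2) (1/(2e²)) M`
(`a H = (e²/2) Σ J² + (1/(2e²)) Σ_p (2 - W_p - W_pᴴ) + matter`). See the module docstring for the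
`e`-convention; `e = 0` is a junk value (`1/0 = 0`). Bietenholz–Wiese (2025) §11.7 eq. (11.48);
Hansson–Oganesyan–Sondhi (2004) §5.2; Kogut–Susskind (1975). [cite: BietenholzWiese2025, §11.7 eq. (11.48)] -/
def gaugedHubbardTorus (L : ℕ) [NeZero L] (U e : ℝ) (M : ℕ) :
    Matrix (Index L M) (Index L M) ℂ :=
  gaugedHubbardTorusWith L U (e ^ 2 / 2) (1 / (2 * e ^ 2)) M

namespace GaugedHubbard

/-! ### The Gauss law -/

section Gauss

variable (L M : ℕ) [NeZero L]

/-- The orbital weight "electron sits at site `y`". [folklore] -/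
def siteWeight (y : FermionTorus 2 L) (o : Orb (FermionTorus 2 L)) : ℤ :=
  if (ofLex o).1 = y then 1 else 0

/-- The orbital weight `±1` for spin `↑ / ↓`. [folklore] -/
def spinWeight (o : Orb (FermionTorus 2 L)) : ℤ :=
  if (ofLex o).2 = 0 then 1 else -1

/-- The number of electrons at site `y` in the occupation configuration `s`. [folklore] -/
def siteOcc (s : Finset (Orb (FermionTorus 2 L))) (y : FermionTorus 2 L) : ℤ :=
  wt (siteWeight L y) s

/-- Twice the spin `2S^z = n_↑ - n_↓` of the occupation configuration `s`. [folklore] -/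
def twoSz (s : Finset (Orb (FermionTorus 2 L))) : ℤ :=
  wt (spinWeight L) s

/-- The lattice divergence `(div m)(y) = Σ_i (m_{(y,i)} - m_{(y-eᵢ,i)})` of a flux configuration.
Bietenholz–Wiese (2025) §11.7, eq. (11.50). [folklore] -/
def divFlux (k : TensorIndex (Bond L) (2 * M + 1)) (y : FermionTorus 2 L) : ℤ :=
  ∑ i : Fin 2, (flux M (k (y, i)) - flux M (k (y.unshift i, i)))

/-- The Gauss charge of a basis state at `y` for the integer background `ρ`:
`(div m)(y) - n_y + ρ y`; physical states have charge `0` everywhere, i.e. `div J = n - ρ`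
(electrons source the flux, `ρ` is a static neutralising background with `Σ ρ = N`).
Bietenholz–Wiese (2025) §11.7, eqs. (11.50)–(11.52); Fradkin (2013) §9.12, eq. (9.84). [folklore] -/
def gaussCharge (ρ : FermionTorus 2 L → ℤ) (y : FermionTorus 2 L) (ik : Index L M) : ℤ :=
  divFlux L M ik.2 y - siteOcc L ik.1 y + ρ y

/-- The Gauss-law generator `G_y = (div J)(y) - n_y + ρ y`, a diagonal operator in the
occupation ⊗ flux basis. Bietenholz–Wiese (2025) §11.7, eq. (11.50); Fradkin (2013) §9.12,
eq. (9.84). [cite: BietenholzWiese2025, §11.7 eq. (11.50)] -/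
def gaussGenerator (ρ : FermionTorus 2 L → ℤ) (y : FermionTorus 2 L) :
    Matrix (Index L M) (Index L M) ℂ :=
  diagonal fun ik => ((gaussCharge L M ρ y ik : ℤ) : ℂ)

/-- A basis state obeys the Gauss law (for the background `ρ`) if all its Gauss charges vanish.
Bietenholz–Wiese (2025) §11.7, eq. (11.52). [folklore] -/
def IsGaussLaw (ρ : FermionTorus 2 L → ℤ) (ik : Index L M) : Prop :=
  ∀ y, gaussCharge L M ρ y ik = 0

/-- The Gauss law is decidable on basis states (finitely many sites). [folklore] -/
instance instDecidablePredIsGaussLaw (ρ : FermionTorus 2 L → ℤ) :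
    DecidablePred (IsGaussLaw L M ρ) :=
  fun ik => inferInstanceAs (Decidable (∀ y, gaussCharge L M ρ y ik = 0))

/-- The constraint projector onto the Gauss-law subspace: diagonal with entry `1` on the basis
states obeying the Gauss law and `0` elsewhere (the projector `P_Q` of Bietenholz–Wiese (2025)
§11.9, eqs. (11.71)–(11.72), "diagonal in the flux basis"). [cite: BietenholzWiese2025, §11.9 eqs. (11.71)–(11.72)] -/
def gaussProj (ρ : FermionTorus 2 L → ℤ) : Matrix (Index L M) (Index L M) ℂ :=
  diagonal fun ik => if IsGaussLaw L M ρ ik then 1 else 0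

/-- The Gauss-law (gauge-invariant) subspace: the joint kernel of all generators `G_y`.
Bietenholz–Wiese (2025) §11.7, eq. (11.52); Fradkin (2013) §9.11, eq. (9.81). [folklore] -/
def gaussLawSubspace (ρ : FermionTorus 2 L → ℤ) : Submodule ℂ (Index L M → ℂ) :=
  ⨅ y : FermionTorus 2 L, LinearMap.ker (Matrix.toLin' (gaussGenerator L M ρ y))

/-- The physical basis states: Gauss law for the background `ρ` and `2S^z = 0` (the particle
number is then `Σ ρ`, `card_eq_sum_of_isGaussLaw`). [folklore] -/
def IsPhysical (ρ : FermionTorus 2 L → ℤ) (ik : Index L M) : Prop :=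
  IsGaussLaw L M ρ ik ∧ twoSz L ik.1 = 0

/-- Physicality is decidable on basis states. [folklore] -/
instance instDecidablePredIsPhysical (ρ : FermionTorus 2 L → ℤ) :
    DecidablePred (IsPhysical L M ρ) :=
  fun ik => inferInstanceAs (Decidable (IsGaussLaw L M ρ ik ∧ twoSz L ik.1 = 0))

end Gauss

end GaugedHubbard

/-- **The physical gauged Hubbard torus**: the compression of `gaugedHubbardTorus L U e M` to the
basis states obeying the Gauss law `div J = n - ρ` with `2S^z = 0` — a coordinate sector left
invariant by `H` (`gaugedHubbardTorusWith_apply_eq_zero_of_not_isPhysical`), so that this finite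
Hermitian matrix carries exactly the gauge-invariant `S^z = 0` spectrum (cf. `sector_groundState`).
Bietenholz–Wiese (2025) §11.7, eqs. (11.52)–(11.53). [folklore] -/
def gaugedHubbardTorusPhys (L : ℕ) [NeZero L] (U e : ℝ) (M : ℕ) (ρ : FermionTorus 2 L → ℤ) :
    Matrix {ik : Index L M // IsPhysical L M ρ ik} {ik : Index L M // IsPhysical L M ρ ik} ℂ :=
  (gaugedHubbardTorus L U e M).submatrix Subtype.val Subtype.val

namespace GaugedHubbard

section API

variable (L M : ℕ) [NeZero L]

/-! ### Hermiticity -/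

/-- **The gauged Hubbard torus is Hermitian.** Kogut–Susskind (1975). [folklore] -/
theorem isHermitian_gaugedHubbardTorusWith (U gE gB : ℝ) :
    (gaugedHubbardTorusWith L U gE gB M).IsHermitian := by
  unfold gaugedHubbardTorusWith
  refine ((IsHermitian.add ?_ ?_).add ?_).add ?_
  · exact (isHermitian_add_transpose_self _).neg
  · exact isHermitian_real_smul U
      (isHermitian_kronecker (isHermitian_sum_numberOp_mul L) isHermitian_one)
  · exact isHermitian_real_smul gE (isHermitian_kronecker isHermitian_one (electric_isHermitian L M))
  · exact isHermitian_real_smul gB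
      (isHermitian_kronecker isHermitian_one (magnetic_isHermitian L M))

/-- `H_e` is Hermitian. Kogut–Susskind (1975). [folklore] -/
theorem isHermitian_gaugedHubbardTorus (U e : ℝ) : (gaugedHubbardTorus L U e M).IsHermitian :=
  isHermitian_gaugedHubbardTorusWith L M U _ _

/-- The physical block is Hermitian. [folklore] -/
theorem isHermitian_gaugedHubbardTorusPhys (U e : ℝ) (ρ : FermionTorus 2 L → ℤ) :
    (gaugedHubbardTorusPhys L U e M ρ).IsHermitian :=
  (isHermitian_gaugedHubbardTorus L M U e).submatrix _

/-! ### Gauge invariance -/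

variable {L M}

/-- The link weights of the divergence at `y`: `(div m)(y) = Σ_b v_y(b) m_b` with
`v_y (z, i) = [z = y] - [z + eᵢ = y]`. [folklore] -/
def divWeight (y : FermionTorus 2 L) (b : Bond L) : ℤ :=
  (if b.1 = y then 1 else 0) - (if b.1.shift b.2 = y then 1 else 0)

/-- `(div m)(y)` as a weighted sum over all bonds. [folklore] -/
theorem divFlux_eq_linkGrade (k : TensorIndex (Bond L) (2 * M + 1)) (y : FermionTorus 2 L) :
    divFlux L M k y = linkGrade L M (divWeight y) k := by
  have h1 : ∑ b : Bond L, (if b.1 = y then flux M (k b) else 0) = ∑ i, flux M (k (y, i)) := by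
    rw [Fintype.sum_prod_type, Finset.sum_comm]
    simp only [Finset.sum_ite_eq', Finset.mem_univ, if_true]
  have h2 : ∑ b : Bond L, (if b.1.shift b.2 = y then flux M (k b) else 0) =
      ∑ i, flux M (k (y.unshift i, i)) := by
    simp only [FermionTorus.shift_eq_iff_eq_unshift]
    rw [Fintype.sum_prod_type, Finset.sum_comm]
    simp only [Finset.sum_ite_eq', Finset.mem_univ, if_true]
  rw [linkGrade]
  simp only [divWeight, sub_mul, ite_mul, one_mul, zero_mul, Finset.sum_sub_distrib, h1, h2,
    divFlux]

/-- The fermionic Gauss grading at `y`: `ρ y - n_y`. [folklore] -/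
def fermionGrade (ρ : FermionTorus 2 L → ℤ) (y : FermionTorus 2 L)
    (s : Finset (Orb (FermionTorus 2 L))) : ℤ :=
  ρ y - siteOcc L s y

/-- The Gauss charge is the sum grading `fermionGrade + linkGrade divWeight`. [folklore] -/
theorem gaussCharge_eq (ρ : FermionTorus 2 L → ℤ) (y : FermionTorus 2 L) :
    gaussCharge L M ρ y = fun ik => fermionGrade ρ y ik.1 + linkGrade L M (divWeight y) ik.2 := by
  funext ik
  rw [gaussCharge, fermionGrade, divFlux_eq_linkGrade]
  ring

omit [NeZero L] in
/-- `c†_{xσ}` carries Gauss charge `-[x = y]` at `y`. Fradkin (2013) §9.12, eq. (9.84). [folklore] -/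
theorem hasShift_creation_orb (ρ : FermionTorus 2 L → ℤ) (y x : FermionTorus 2 L) (σ : Fin 2) :
    HasShift (fermionGrade ρ y) (creation (orb x σ)) (-(if x = y then 1 else 0)) := by
  have hw : siteWeight L y (orb x σ) = if x = y then 1 else 0 := by simp [siteWeight]
  intro s t hst
  have h := hasShift_creation (siteWeight L y) (orb x σ) s t hst
  rw [hw] at h
  unfold fermionGrade siteOcc
  linarith

omit [NeZero L] in
/-- `c_{xσ}` carries Gauss charge `+[x = y]` at `y`. Fradkin (2013) §9.12, eq. (9.84). [folklore] -/
theorem hasShift_annihilation_orb (ρ : FermionTorus 2 L → ℤ) (y x : FermionTorus 2 L)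
    (σ : Fin 2) :
    HasShift (fermionGrade ρ y) (annihilation (orb x σ)) (if x = y then 1 else 0) := by
  have hw : siteWeight L y (orb x σ) = if x = y then 1 else 0 := by simp [siteWeight]
  intro s t hst
  have h := hasShift_annihilation (siteWeight L y) (orb x σ) s t hst
  rw [hw] at h
  unfold fermionGrade siteOcc
  linarith

/-- The plaquette loop is gauge neutral (the four bond charges telescope around the plaquette).
Bietenholz–Wiese (2025) §11.7, eq. (11.50). [folklore] -/
theorem hasShift_plaquetteLoop (y x : FermionTorus 2 L) :
    HasShift (linkGrade L M (divWeight y)) (plaquetteLoop L M x) 0 := by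
  have hU : ∀ b : Bond L, HasShift (linkGrade L M (divWeight y)) (linkRaise L M b)
      (divWeight y b) := fun b => hasShift_linkRaise L M _ b
  unfold plaquetteLoop
  refine ((((hU (x, 0)).mul (hU (x.shift 0, 1))).mul
    (hU (x.shift 1, 0)).conjTranspose).mul (hU (x, 1)).conjTranspose).of_eq ?_
  simp only [divWeight, FermionTorus.shift_shift_comm x 1 0]
  ring

/-- The magnetic energy is gauge neutral. [folklore] -/
theorem hasShift_magnetic (y : FermionTorus 2 L) :
    HasShift (linkGrade L M (divWeight y)) (magnetic L M) 0 := by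
  unfold magnetic
  refine HasShift.sum _ fun x _ => ?_
  refine (HasShift.one.sub (hasShift_plaquetteLoop y x)).add ?_
  simpa using (HasShift.one.sub (hasShift_plaquetteLoop (M := M) y x)).conjTranspose

/-- The covariant hopping is gauge neutral: the charge `-[x = y] + [x + eᵢ = y]` of
`c†_x c_{x+eᵢ}` is compensated by the charge `[x = y] - [x + eᵢ = y]` of `U_{(x,i)}`.
Fradkin (2013) §9.12, eqs. (9.83)–(9.84). [folklore] -/
theorem hasShift_hopCore (ρ : FermionTorus 2 L → ℤ) (y : FermionTorus 2 L) :
    HasShift (fun ik : Index L M => fermionGrade ρ y ik.1 + linkGrade L M (divWeight y) ik.2)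
      (hopCore L M) 0 := by
  unfold hopCore
  refine HasShift.sum _ fun b _ => HasShift.sum _ fun σ _ => ?_
  refine (((hasShift_creation_orb ρ y b.1 σ).mul
    (hasShift_annihilation_orb ρ y _ σ)).kronecker (hasShift_linkRaise L M _ b)).of_eq ?_
  simp only [divWeight]
  ring

/-- **Every term of `H` is gauge neutral**: `H` does not connect different Gauss-charge sectors.
Bietenholz–Wiese (2025) §11.7, eq. (11.50); Fradkin (2013) §9.11, eq. (9.80). [folklore] -/
theorem hasShift_gaugedHubbardTorusWith (U gE gB : ℝ) (ρ : FermionTorus 2 L → ℤ)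
    (y : FermionTorus 2 L) :
    HasShift (gaussCharge L M ρ y) (gaugedHubbardTorusWith L U gE gB M) 0 := by
  have hcore := hasShift_hopCore (M := M) ρ y
  have hnn : HasShift (fermionGrade ρ y)
      (∑ x : FermionTorus 2 L, numberOp x 0 * numberOp x 1) 0 := by
    refine HasShift.sum _ fun x _ => ?_
    have h0 := (hasShift_creation_orb ρ y x 0).mul (hasShift_annihilation_orb ρ y x 0)
    have h1 := (hasShift_creation_orb ρ y x 1).mul (hasShift_annihilation_orb ρ y x 1)
    refine (h0.mul h1).of_eq ?_
    ring
  have hfull : HasShift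
      (fun ik : Index L M => fermionGrade ρ y ik.1 + linkGrade L M (divWeight y) ik.2)
      (gaugedHubbardTorusWith L U gE gB M) 0 := by
    unfold gaugedHubbardTorusWith
    refine (((hcore.add (by simpa using hcore.conjTranspose)).neg.add ?_).add ?_).add ?_
    · simpa using (hnn.kronecker
        (HasShift.one (d := linkGrade L M (divWeight y)))).smul (U : ℂ)
    · simpa using ((HasShift.one (d := fermionGrade ρ y)).kronecker
        (hasShift_electric L M (linkGrade L M (divWeight y)))).smul (gE : ℂ)
    · simpa using ((HasShift.one (d := fermionGrade ρ y)).kronecker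
        (hasShift_magnetic (M := M) y)).smul (gB : ℂ)
  exact hfull.congr_grading (gaussCharge_eq ρ y).symm

/-- **Gauge invariance**: `[H, G_y] = 0` for every site `y` and every background `ρ`.
Bietenholz–Wiese (2025) §11.7, eq. (11.50); Fradkin (2013) §9.11, eq. (9.80); Kogut–Susskind
(1975). [cite: BietenholzWiese2025, §11.7 eq. (11.50)] -/
theorem commute_gaussGenerator_gaugedHubbardTorusWith (U gE gB : ℝ) (ρ : FermionTorus 2 L → ℤ)
    (y : FermionTorus 2 L) :
    Commute (gaussGenerator L M ρ y) (gaugedHubbardTorusWith L U gE gB M) := by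
  unfold gaussGenerator
  exact HasShift.commute_diagonal fun i j h => by
    rw [hasShift_gaugedHubbardTorusWith U gE gB ρ y i j h, add_zero]

/-- Gauge invariance of `H_e`. Bietenholz–Wiese (2025) §11.7, eq. (11.50). [folklore] -/
theorem commute_gaussGenerator_gaugedHubbardTorus (U e : ℝ) (ρ : FermionTorus 2 L → ℤ)
    (y : FermionTorus 2 L) :
    Commute (gaussGenerator L M ρ y) (gaugedHubbardTorus L U e M) :=
  commute_gaussGenerator_gaugedHubbardTorusWith _ _ _ ρ y

/-- The Gauss generators commute with each other (they are diagonal).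
Bietenholz–Wiese (2025) §11.7, eq. (11.50); Fradkin (2013) §9.11, eq. (9.80). [folklore] -/
theorem commute_gaussGenerator (ρ : FermionTorus 2 L → ℤ) (x y : FermionTorus 2 L) :
    Commute (gaussGenerator L M ρ x) (gaussGenerator L M ρ y) := by
  rw [Commute, SemiconjBy, gaussGenerator, gaussGenerator, diagonal_mul_diagonal,
    diagonal_mul_diagonal]
  congr 1
  funext ik
  ring

/-- The Gauss generators are Hermitian. [folklore] -/
theorem gaussGenerator_isHermitian (ρ : FermionTorus 2 L → ℤ) (y : FermionTorus 2 L) :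
    (gaussGenerator L M ρ y).IsHermitian := by
  unfold gaussGenerator
  exact isHermitian_diagonal_of_self_adjoint _ (funext fun _ => by simp)

/-- **Block structure**: `H` has no entries between basis states with different Gauss charges.
[folklore] -/
theorem gaugedHubbardTorusWith_apply_eq_zero_of_gaussCharge_ne (U gE gB : ℝ)
    (ρ : FermionTorus 2 L → ℤ) (y : FermionTorus 2 L) {i j : Index L M}
    (h : gaussCharge L M ρ y i ≠ gaussCharge L M ρ y j) :
    gaugedHubbardTorusWith L U gE gB M i j = 0 :=
  (hasShift_gaugedHubbardTorusWith U gE gB ρ y).apply_eq_zero (by rwa [add_zero])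

/-- `H` conserves `2S^z`: no entries between different spin sectors. [folklore] -/
theorem hasShift_twoSz_gaugedHubbardTorusWith (U gE gB : ℝ) :
    HasShift (fun ik : Index L M => twoSz L ik.1) (gaugedHubbardTorusWith L U gE gB M) 0 := by
  have hc : ∀ (x : FermionTorus 2 L) (σ : Fin 2),
      HasShift (twoSz L) (creation (orb x σ)) (spinWeight L (orb x σ)) :=
    fun x σ => hasShift_creation (spinWeight L) _
  have ha : ∀ (x : FermionTorus 2 L) (σ : Fin 2),
      HasShift (twoSz L) (annihilation (orb x σ)) (-spinWeight L (orb x σ)) :=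
    fun x σ => hasShift_annihilation (spinWeight L) _
  have hw : ∀ (x : FermionTorus 2 L) (σ : Fin 2),
      spinWeight L (orb x σ) = if σ = 0 then 1 else -1 := fun x σ => by
    simp [spinWeight]
  have hcore : HasShift (fun ik : Index L M => twoSz L ik.1 + (fun _ => (0 : ℤ)) ik.2)
      (hopCore L M) 0 := by
    unfold hopCore
    refine HasShift.sum _ fun b _ => HasShift.sum _ fun σ _ => ?_
    refine (((hc b.1 σ).mul (ha _ σ)).kronecker (HasShift.of_const (linkRaise L M b) 0)).of_eq ?_
    rw [hw, hw]
    ring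
  have hnn : HasShift (twoSz L) (∑ x : FermionTorus 2 L, numberOp x 0 * numberOp x 1) 0 := by
    refine HasShift.sum _ fun x _ => ?_
    refine (((hc x 0).mul (ha x 0)).mul ((hc x 1).mul (ha x 1))).of_eq ?_
    ring
  have hfull : HasShift (fun ik : Index L M => twoSz L ik.1 + (fun _ => (0 : ℤ)) ik.2)
      (gaugedHubbardTorusWith L U gE gB M) 0 := by
    unfold gaugedHubbardTorusWith
    refine (((hcore.add (by simpa using hcore.conjTranspose)).neg.add ?_).add ?_).add ?_
    · simpa using (hnn.kronecker
        (HasShift.of_const (1 : Op (Bond L) (2 * M + 1)) 0)).smul (U : ℂ)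
    · simpa using ((HasShift.one (d := twoSz L)).kronecker
        (HasShift.of_const (electric L M) 0)).smul (gE : ℂ)
    · simpa using ((HasShift.one (d := twoSz L)).kronecker
        (HasShift.of_const (magnetic L M) 0)).smul (gB : ℂ)
  exact hfull.congr_grading (funext fun ik => by simp)

/-- **The physical sector is invariant**: `H` has no entries from non-physical to physical basis
states (the hypothesis `hinv` of `sector_groundState`). [folklore] -/
theorem gaugedHubbardTorusWith_apply_eq_zero_of_not_isPhysical (U gE gB : ℝ)
    (ρ : FermionTorus 2 L → ℤ) {i j : Index L M} (hi : ¬ IsPhysical L M ρ i)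
    (hj : IsPhysical L M ρ j) : gaugedHubbardTorusWith L U gE gB M i j = 0 := by
  by_contra h0
  refine hi ⟨fun y => ?_, ?_⟩
  · rw [hasShift_gaugedHubbardTorusWith U gE gB ρ y i j h0, hj.1 y, zero_add]
  · have h2 := hasShift_twoSz_gaugedHubbardTorusWith U gE gB i j h0
    beta_reduce at h2
    rw [h2, hj.2, zero_add]

/-- `gaussProj` is an idempotent. Bietenholz–Wiese (2025) §11.9. [folklore] -/
theorem gaussProj_idempotent (ρ : FermionTorus 2 L → ℤ) :
    IsIdempotentElem (gaussProj L M ρ) := by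
  rw [IsIdempotentElem, gaussProj, diagonal_mul_diagonal]
  congr 1
  funext ik
  split_ifs <;> simp

/-- `gaussProj` is Hermitian. Bietenholz–Wiese (2025) §11.9. [folklore] -/
theorem gaussProj_isHermitian (ρ : FermionTorus 2 L → ℤ) : (gaussProj L M ρ).IsHermitian := by
  unfold gaussProj
  refine isHermitian_diagonal_of_self_adjoint _ (funext fun ik => ?_)
  by_cases h : IsGaussLaw L M ρ ik
  · simp [h]
  · simp [h]

/-- `gaussProj` commutes with `H`: the constraint is compatible with the dynamics.
Bietenholz–Wiese (2025) §11.9, eq. (11.71); Fradkin (2013) §9.11, eq. (9.80). [folklore] -/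
theorem commute_gaussProj_gaugedHubbardTorusWith (U gE gB : ℝ) (ρ : FermionTorus 2 L → ℤ) :
    Commute (gaussProj L M ρ) (gaugedHubbardTorusWith L U gE gB M) := by
  unfold gaussProj
  exact HasShift.commute_diagonal fun i j h => by
    have hij : ∀ y, gaussCharge L M ρ y i = gaussCharge L M ρ y j := fun y => by
      rw [hasShift_gaugedHubbardTorusWith U gE gB ρ y i j h, add_zero]
    by_cases hi : IsGaussLaw L M ρ i
    · have hj : IsGaussLaw L M ρ j := fun y => (hij y) ▸ hi y
      rw [if_pos hi, if_pos hj]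
    · have hj : ¬ IsGaussLaw L M ρ j := fun hj => hi fun y => (hij y).symm ▸ hj y
      rw [if_neg hi, if_neg hj]

/-- The Gauss-law subspace is a coordinate sector: `ψ` is gauge invariant iff it is supported on
the basis states obeying the Gauss law (the hypothesis `hK` of `sector_groundState`).
Bietenholz–Wiese (2025) §11.9, eq. (11.71). [folklore] -/
theorem mem_gaussLawSubspace_iff (ρ : FermionTorus 2 L → ℤ) (ψ : Index L M → ℂ) :
    ψ ∈ gaussLawSubspace L M ρ ↔ ∀ ik, ¬ IsGaussLaw L M ρ ik → ψ ik = 0 := by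
  simp only [gaussLawSubspace, Submodule.mem_iInf, LinearMap.mem_ker, Matrix.toLin'_apply,
    gaussGenerator, funext_iff, mulVec_diagonal, Pi.zero_apply, mul_eq_zero, Int.cast_eq_zero,
    IsGaussLaw, not_forall]
  constructor
  · rintro h ik ⟨y, hy⟩
    exact (h y ik).resolve_left hy
  · intro h y ik
    by_cases hy : gaussCharge L M ρ y ik = 0
    · exact Or.inl hy
    · exact Or.inr (h ik ⟨y, hy⟩)

/-- **Charge neutrality of the Gauss law**: a basis state obeying `div J = n - ρ` has exactly
`Σ_y ρ y` electrons (sum the Gauss law over the torus; the divergences telescope to zero).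
Bietenholz–Wiese (2025) §11.7, after eq. (11.52). [folklore] -/
theorem card_eq_sum_of_isGaussLaw (ρ : FermionTorus 2 L → ℤ) {ik : Index L M}
    (h : IsGaussLaw L M ρ ik) : (ik.1.card : ℤ) = ∑ y, ρ y := by
  have hsum : ∑ y, gaussCharge L M ρ y ik = 0 := Finset.sum_eq_zero fun y _ => h y
  have hdiv : ∑ y, divFlux L M ik.2 y = 0 := by
    simp only [divFlux_eq_linkGrade, linkGrade]
    rw [Finset.sum_comm]
    refine Finset.sum_eq_zero fun b _ => ?_
    rw [← Finset.sum_mul]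
    have : ∑ y, divWeight y b = 0 := by
      simp only [divWeight, Finset.sum_sub_distrib, Finset.sum_ite_eq, Finset.mem_univ, if_true,
        sub_self]
    rw [this, zero_mul]
  have hocc : ∑ y, siteOcc L ik.1 y = ik.1.card := by
    simp only [siteOcc, wt, siteWeight]
    rw [Finset.sum_comm]
    simp
  simp only [gaussCharge, Finset.sum_add_distrib, Finset.sum_sub_distrib, hdiv, hocc] at hsum
  linarith

end API

end GaugedHubbard

end Literature.MathematicalPhysics.QuantumLattice
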